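import Summits.Ventures.PercRepro.S2RowFifteenOpenEight
import Summits.Ventures.PercRepro.S2FifteenTen
import Summits.Ventures.PercRepro.S2FifteenEleven
import Summits.Ventures.PercRepro.S2FifteenTwelve
import Summits.Ventures.PercRepro.S2FifteenThirteen
import Summits.Ventures.PercRepro.S2FifteenFourteen
import Summits.Ventures.PercRepro.S2FifteenSixteen

/-!
# PercRepro — S2: THE `p = 15` ROW — THE TWO OPEN CELLS AS ONE HYPOTHESIS (p7, gen 12; sub-claim S2)

With the six cells `(15, 10)`, `(15, 11)`, `(15, 12)`, `(15, 13)`, `(15, 14)`, `(15, 16)` tree theorems by the concentrated tail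
(S2FifteenTen … S2FifteenSixteen, on S2TailCell / S2SpanningCount), the «16» assembly needs only the TWO cells `(15, 6)` and `(15, 7)`:
**`c025_five_large_sharp16_of_two_cells`** — C-025 at level `5` for every `p ≥ 16` from `RLS M 15 5` on the `e`-free cores of rank
`15` and corank `d ∈ {6, 7}`. Those two are priced OPEN in their SPREAD case (no set of nullity `4` on `≤ 9` points: `(15, 6)` 1.215,
`(15, 7)` 1.060 — the concentrated tail has no `W` to count below there, and the kit's spanning bound `Σ_{j ≤ d} C(n, j)` is exact on
a uniform matroid). Nothing here asserts a window move. Axioms: standard.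
-/

open scoped Matroid

namespace PercRepro

namespace ThmN

variable {α : Type}

/-- **THEOREM C₅ AT `16` MODULO THE TWO OPEN CELLS** `(15, 6)` and `(15, 7)`. -/
theorem c025_five_large_sharp16_of_two_cells
    (htwo : ∀ (M : Matroid α) [M.Finite] (d : ℕ), 6 ≤ d → d ≤ 7 →
      M.eRank = ((15 : ℕ) : ℕ∞) → M.E.ncard = 15 + d →
      (∀ e ∈ M.E, ∃ A ⊆ M.E \ {e}, e ∉ M.closure A ∧ e ∉ M.closure ((M.E \ {e}) \ A)) → RLS M 15 5)
    (M : Matroid α) [M.Finite] (p : ℕ) (hp : 16 ≤ p) : RLS M p 5 := by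
  refine c025_five_large_sharp16_of_eight_cells ?_ M p hp
  intro M _ d hd6 hd16 hd8 hd9 hd15 hR hn hfree
  by_cases h10 : d = 10
  · subst h10
    exact c025_core_five_fifteen_ten M hR hn hfree
  by_cases h11 : d = 11
  · subst h11
    exact c025_core_five_fifteen_eleven M hR hn hfree
  by_cases h12 : d = 12
  · subst h12
    exact c025_core_five_fifteen_twelve M hR hn hfree
  by_cases h13 : d = 13
  · subst h13
    exact c025_core_five_fifteen_thirteen M hR hn hfree
  by_cases h14 : d = 14
  · subst h14
    exact c025_core_five_fifteen_fourteen M hR hn hfree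
  by_cases h16 : d = 16
  · subst h16
    exact c025_core_five_fifteen_sixteen M hR hn hfree
  exact htwo M d hd6 (by omega) hR hn hfree

end ThmN

end PercRepro
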